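import Mathlib
import Literature.Analysis.Matrix.RadialKernelPosSemidef
import Literature.Analysis.Matrix.RadialKernelPosDef

/-!
# Ohno–PPP interaction matrix: positive (semi)definiteness (staging v2, deq-2 / DEQ-A114 (ex 'DEQ-A109') / T24)

HONEST FRAMING: instance-level adjudication of specific advantage claims; no claim about
BQP vs BPP or the summit.

Content.  `InverseMultiquadricPosDef` is a PUBLISHED theorem stated as a named `Prop`
(Wendland, *Scattered Data Approximation*, Cambridge Univ. Press 2005, Theorem 7.15 with β = 1/2,
c > 0; also Micchelli, Constr. Approx. 2 (1986) 11–22): the inverse-multiquadric kernel matrix on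
pairwise distinct points of `ℝ^d` is positive definite, for every `d`.  `OhnoMatrixPosDef` is the
statement used in DEQ-A109 §2: the Ohno-parametrised PPP interaction matrix
`V_ii = u`, `V_ij = u / √(1 + α r_ij²)` (arXiv:2605.00745v1, Eq. (2); u, α > 0) is positive definite
for every geometry of pairwise distinct sites.  `ohnoMatrixPosDef_of_imq` PROVES the reduction
(the Ohno kernel is the positive multiple `u/√α` of the IMQ kernel with `c = 1/√α`), so the only
unproved input is the cited textbook theorem.  Positive definiteness of `V` is exactly the hypothesis
under which the auxiliary-field QMC of Hohenadler–Parisen Toldin–Herbut–Assaad (PRB 90, 085146 (2014),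
arXiv:1407.2708) is sign-problem free at half filling.

v2 (gen 20, after the tree landing p233601 `Literature/Analysis/Matrix/RadialKernelPosSemidef.lean`,
lead STATUS 2026-08-20T19:34Z): the positive-SEMIdefinite statement is now UNCONDITIONAL —
`ohnoMatrix_posSemidef` below derives `(ohnoMatrix d N u α x).PosSemidef` for every `u ≥ 0`, `α > 0`
and every family of sites (repetitions allowed) from the tree theorem
`Literature.Analysis.Matrix.posSemidef_div_sqrt` (Wendland Thm 7.15, semidefinite part, PROVED in the
tree via Schoenberg/BCR).  The STRICT statement `OhnoMatrixPosDef` keeps the strict IMQ theorem as the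
explicit hypothesis `InverseMultiquadricPosDef` (lead ruling 19:15Z (4): a hypothesis, not a Literature
fact).  DEQ-A114's comparator precondition as used (real Hubbard–Stratonovich decoupling of
½ Σ V_ij (n_i − 1)(n_j − 1)) needs only `V ≽ 0`; strictness (margin λ_min ≥ 1.24 eV on the paper's 15
molecules) is the certified numerical statement of toy T24, not a Lean claim.
-/

namespace Summit.QuantumAdvantage.Dequantization.OhnoPPP

/-- Inverse-multiquadric kernel matrix `(c² + ‖xᵢ - xⱼ‖²)^(-1/2)` on `N` points of `ℝ^d`. -/
noncomputable def imqMatrix (d N : ℕ) (c : ℝ) (x : Fin N → EuclideanSpace ℝ (Fin d)) :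
    Matrix (Fin N) (Fin N) ℝ :=
  Matrix.of fun i j => 1 / Real.sqrt (c ^ 2 + ‖x i - x j‖ ^ 2)

/-- PUBLISHED FACT (Wendland 2005, Thm 7.15, β = 1/2; Micchelli 1986): inverse multiquadrics are
(strictly) positive definite on every `ℝ^d`: the kernel matrix on pairwise distinct points is
positive definite. -/
def InverseMultiquadricPosDef : Prop :=
  ∀ (d N : ℕ) (c : ℝ), 0 < c → ∀ x : Fin N → EuclideanSpace ℝ (Fin d), Function.Injective x →
    (imqMatrix d N c x).PosDef

/-- Ohno–PPP interaction matrix of arXiv:2605.00745v1 Eq. (2): `V_ij = u / √(1 + α ‖xᵢ - xⱼ‖²)`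
(so `V_ii = u`). -/
noncomputable def ohnoMatrix (d N : ℕ) (u α : ℝ) (x : Fin N → EuclideanSpace ℝ (Fin d)) :
    Matrix (Fin N) (Fin N) ℝ :=
  Matrix.of fun i j => u / Real.sqrt (1 + α * ‖x i - x j‖ ^ 2)

/-- The statement used in DEQ-A109 §2 (T24 checks it numerically for the paper's 15 molecules). -/
def OhnoMatrixPosDef : Prop :=
  ∀ (d N : ℕ) (u α : ℝ), 0 < u → 0 < α → ∀ x : Fin N → EuclideanSpace ℝ (Fin d),
    Function.Injective x → (ohnoMatrix d N u α x).PosDef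

/-- Pointwise identity: `u / √(1 + α r²) = (u / √α) · (1 / √((√α)⁻¹ ^ 2 + r²))` for `α > 0`. -/
theorem ohno_kernel_eq (u α r : ℝ) (hα : 0 < α) :
    u / Real.sqrt (1 + α * r ^ 2)
      = (u / Real.sqrt α) * (1 / Real.sqrt ((Real.sqrt α)⁻¹ ^ 2 + r ^ 2)) := by
  have hs : 0 < Real.sqrt α := Real.sqrt_pos.mpr hα
  have h1 : (Real.sqrt α)⁻¹ ^ 2 + r ^ 2 = (1 + α * r ^ 2) / α := by
    rw [inv_pow, Real.sq_sqrt hα.le]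
    field_simp
  have h2 : 0 < Real.sqrt (1 + α * r ^ 2) := Real.sqrt_pos.mpr (by positivity)
  rw [h1, Real.sqrt_div' _ hα.le]
  field_simp

/-- The Ohno matrix is the positive multiple `u/√α` of an IMQ kernel matrix with `c = (√α)⁻¹`. -/
theorem ohnoMatrix_eq_smul_imq (d N : ℕ) (u α : ℝ) (hα : 0 < α)
    (x : Fin N → EuclideanSpace ℝ (Fin d)) :
    ohnoMatrix d N u α x = (u / Real.sqrt α) • imqMatrix d N (Real.sqrt α)⁻¹ x := by
  ext i j
  simp only [ohnoMatrix, imqMatrix, Matrix.of_apply, Matrix.smul_apply, smul_eq_mul]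
  exact ohno_kernel_eq u α ‖x i - x j‖ hα

/-- REDUCTION (proved): the published IMQ theorem implies positive definiteness of every Ohno–PPP
interaction matrix with `u, α > 0` on pairwise distinct sites. -/
theorem ohnoMatrixPosDef_of_imq (h : InverseMultiquadricPosDef) : OhnoMatrixPosDef := by
  intro d N u α hu hα x hx
  rw [ohnoMatrix_eq_smul_imq d N u α hα x]
  have hc : 0 < (Real.sqrt α)⁻¹ := inv_pos.mpr (Real.sqrt_pos.mpr hα)
  have hk : 0 < u / Real.sqrt α := div_pos hu (Real.sqrt_pos.mpr hα)
  exact (h d N _ hc x hx).smul hk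

/-- Pointwise identity in the `K / √(c² + r²)` form of the tree lemma `posSemidef_div_sqrt`. -/
theorem ohno_kernel_eq_div (u α r : ℝ) (hα : 0 < α) :
    u / Real.sqrt (1 + α * r ^ 2)
      = (u / Real.sqrt α) / Real.sqrt ((Real.sqrt α)⁻¹ ^ 2 + r ^ 2) := by
  rw [ohno_kernel_eq u α r hα, mul_one_div]

/-- UNCONDITIONAL (v2): every Ohno–PPP interaction matrix with `u ≥ 0`, `α > 0` is positive
semidefinite, for any family of sites in any `ℝ^d` — from the tree theorem
`Literature.Analysis.Matrix.posSemidef_div_sqrt` (inverse multiquadric, β = 1/2, semidefinite part of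
Wendland 2005 Thm 7.15, proved there via BCR Ch. 3 Thm 2.3). -/
theorem ohnoMatrix_posSemidef (d N : ℕ) (u α : ℝ) (hu : 0 ≤ u) (hα : 0 < α)
    (x : Fin N → EuclideanSpace ℝ (Fin d)) : (ohnoMatrix d N u α x).PosSemidef := by
  have hc : (Real.sqrt α)⁻¹ ≠ 0 := inv_ne_zero (Real.sqrt_pos.mpr hα).ne'
  have hK : 0 ≤ u / Real.sqrt α := div_nonneg hu (Real.sqrt_nonneg α)
  have h := Literature.Analysis.Matrix.posSemidef_div_sqrt (E := EuclideanSpace ℝ (Fin d)) hc hK x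
  have e : ohnoMatrix d N u α x
      = Matrix.of fun i j : Fin N => (u / Real.sqrt α) / Real.sqrt ((Real.sqrt α)⁻¹ ^ 2 + ‖x i - x j‖ ^ 2) := by
    ext i j
    simp only [ohnoMatrix, Matrix.of_apply]
    exact ohno_kernel_eq_div u α ‖x i - x j‖ hα
  rw [e]; exact h

/-- The quadratic form of the Ohno interaction is nonnegative on every real charge-fluctuation
vector `q` (the form in which DEQ-A114 §2 uses it: `½ qᵀ V q ≥ 0`). -/
theorem ohno_quadForm_nonneg (d N : ℕ) (u α : ℝ) (hu : 0 ≤ u) (hα : 0 < α)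
    (x : Fin N → EuclideanSpace ℝ (Fin d)) (q : Fin N → ℝ) :
    0 ≤ q ⬝ᵥ (ohnoMatrix d N u α x).mulVec q := by
  simpa using (ohnoMatrix_posSemidef d N u α hu hα x).dotProduct_mulVec_nonneg q

/-! ### v3 (2026-08-21, cell lead harvest-1 gen 17): the strict statements DISCHARGED

The tree now proves the strict halves of Wendland's Theorems 6.10 / 7.15
(`Literature/Analysis/Matrix/RadialKernelPosDef.lean`: `posDef_gaussian`,
`posDef_inverseMultiquadric`, `posDef_div_sqrt` — `Matrix.PosDef` on every INJECTIVE family of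
points of a real inner product space), so the hypothesis `InverseMultiquadricPosDef` above holds
and, through the proved reduction `ohnoMatrixPosDef_of_imq`, so does `OhnoMatrixPosDef`: every
Ohno–PPP interaction matrix with `u, α > 0` on pairwise distinct sites is positive DEFINITE.  The
two `def … : Prop` are kept (users' `(h : …)` binders are now fed `…_holds`). -/

/-- DISCHARGE of the published hypothesis: inverse-multiquadric kernel matrices (`β = 1/2`,
`c > 0`) on pairwise distinct points of `ℝ^d` are positive definite — Wendland 2005 Thm 7.15 in the
strict sense of his Definition 6.1, now a tree theorem
(`Literature.Analysis.Matrix.posDef_div_sqrt`). -/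
theorem inverseMultiquadricPosDef_holds : InverseMultiquadricPosDef := by
  intro d N c hc x hx
  unfold imqMatrix
  exact Literature.Analysis.Matrix.posDef_div_sqrt (E := EuclideanSpace ℝ (Fin d)) hc.ne' one_pos x hx

/-- DISCHARGE: every Ohno–PPP interaction matrix `V_ij = u/√(1 + α‖x_i − x_j‖²)` with `u, α > 0`
on pairwise distinct sites is positive definite (the reduction `ohnoMatrixPosDef_of_imq` fed with
`inverseMultiquadricPosDef_holds`). -/
theorem ohnoMatrixPosDef_holds : OhnoMatrixPosDef :=
  ohnoMatrixPosDef_of_imq inverseMultiquadricPosDef_holds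

/-- The strict quadratic-form statement in the form DEQ-A114 §2 uses it: for `u, α > 0`, pairwise
distinct sites and any nonzero real charge-fluctuation vector `q`, `qᵀ V q > 0`. -/
theorem ohno_quadForm_pos (d N : ℕ) (u α : ℝ) (hu : 0 < u) (hα : 0 < α)
    (x : Fin N → EuclideanSpace ℝ (Fin d)) (hx : Function.Injective x)
    (q : Fin N → ℝ) (hq : q ≠ 0) :
    0 < q ⬝ᵥ (ohnoMatrix d N u α x).mulVec q := by
  simpa using (ohnoMatrixPosDef_holds d N u α hu hα x hx).dotProduct_mulVec_pos hq

end Summit.QuantumAdvantage.Dequantization.OhnoPPP
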